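import Summits.HodgeConjecture.CorCM.Census.CoinvariantFibre
import Summits.HodgeConjecture.CorCM.Census.BlockParityHodgeFamilies

/-!
# Uniform twist generation, I: THE GENERIC ENGINES — potential descent, restricted star reduction, base-change stability

COR-CM (cell `pub-hodgecm2`), count-neutral kernel combinatorics by the binder seat b09 (gen 36; lane UNIFORM TWIST GENERATION,
part I), in seat b09ʼs intrinsic currency (`CMF G c`, `typeSum`, `oflipCM`, `gface`/`gfaceSet`, `thetaG`:
`CorCM/Prior/AllgGroup1/2.lean`; `rt`, `translates`: `Census/BlockParityLaw.lean`; `pair`/`pairSet`/`hodgeSpan`: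
`Census/CoinvariantFibre.lean`) used BY NAME.  Theorems only: no definition, no `decide`, no certificate, no named fact, no `sorry`.
HONEST FRAMING: `HC_CM` is NOT proved, here or anywhere in the tree; nothing here is a period or a headline.

Three engines, for an ARBITRARY finite group `G` with an involution `c` (`c * c = 1`), free of any datum:

* §1 **Base-change stability** of `ℤ⟨pairs⟩ + ℤ⟨base changes of S⟩` (`mapDomain_rt_mem_span_translates`, `mapDomain_rt_mem_psp`) and the
  type sum of a base change (`typeSum_mapDomain_rt`).
* §2 **POTENTIAL DESCENT** (`descent`, b23ʼs `CyclicFacesResidue.descent` freed of the boundary potential): for ANY `P : CMF G c → ℕ` and ANY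
  residual predicate `Res`, if a submodule `L` holds through every non-residual type a face relation whose three other corners have smaller `P`,
  then every vector is congruent modulo `L` to one supported on residual types.
* §3 **RESTRICTED STAR REDUCTION** (`single_sub_thetaG_mem_of`, the Prior induction `single_sub_thetaG_mem` with a restricted face supply): for a
  base type `T₀`, a class `U` of types and a submodule `L`, if through every `Φ ∈ U` deviating from `T₀` at `≥ 2` places `L` holds a face relation
  at two deviation places whose three other corners lie in `U`, then `[Φ] − θ_{T₀}(typeSum [Φ]) ∈ L` for every `Φ ∈ U` — the STAR FORM
  `[Φ] ≡ Σ_{t ∈ T₀ ∖ Φ} [T₀^{(t)}] − (|T₀ ∖ Φ| − 1)[T₀]` holds modulo `L` (`thetaG_typeSum_single`).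

Parts II–VI (`Census/TwistGeneration{Model,Cover,Residual,Closing,Law}.lean`) run these engines along a datum `θ : G ≃ ℤ/2n × B`.

## References
* [Pohlmann1968] H. Pohlmann, Algebraic cycles on abelian varieties of complex multiplication type, Ann. of Math. 88 (1968), Thm 1.
* [Milne1999] J. S. Milne, Lefschetz motives and the Tate conjecture, Compositio Math. 117 (1999), Prop. 2.1, p. 54.
-/

namespace Summit.HodgeConjecture.CorCM.Census.TwistGeneration

open Finset
open Summit.HodgeConjecture.CorCM.Prior.AllgGroup.RfwfAllgGroup
open Summit.HodgeConjecture.CorCM.Census.BlockParity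
open Summit.HodgeConjecture.CorCM.Census.Coinvariant

noncomputable section

variable {G : Type*} [Group G] [Fintype G] [DecidableEq G] (c : G)

/-! ## §1 Base-change stability -/

/-- **Base changes of base changes of `S` are base changes of `S`**: `ℤ⟨translates S⟩` is `rt`-stable. [folklore] -/
theorem mapDomain_rt_mem_span_translates (Q : G) (S : Finset (CMF G c →₀ ℤ)) {x : CMF G c →₀ ℤ}
    (hx : x ∈ Submodule.span ℤ (translates c S)) :
    Finsupp.mapDomain (rt c Q) x ∈ Submodule.span ℤ (translates c S) := by
  have h : Submodule.map (Finsupp.lmapDomain ℤ ℤ (rt c Q)) (Submodule.span ℤ (translates c S)) ≤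
      Submodule.span ℤ (translates c S) := by
    rw [Submodule.map_span, Submodule.span_le]
    rintro _ ⟨_, ⟨Q', s, hs, rfl⟩, rfl⟩
    rw [Finsupp.lmapDomain_apply, ← Finsupp.mapDomain_comp]
    refine Submodule.subset_span ⟨Q * Q', s, hs, ?_⟩
    congr 1
    funext Ψ
    simp only [Function.comp_apply, rt_mul]
  exact h (Submodule.mem_map_of_mem hx)

/-- The elements of `S` are base changes of `S` (along `1`). [folklore] -/
theorem mem_span_translates_of_mem (S : Finset (CMF G c →₀ ℤ)) {s : CMF G c →₀ ℤ} (hs : s ∈ S) :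
    s ∈ Submodule.span ℤ (translates c S) := by
  refine Submodule.subset_span ⟨1, s, hs, ?_⟩
  have h : rt c (1 : G) = id := funext fun Ψ => rt_one c Ψ
  rw [h, Finsupp.mapDomain_id]

/-- For central `c`, **`ℤ⟨pairs⟩ + ℤ⟨translates S⟩` is base-change stable.** [folklore] -/
theorem mapDomain_rt_mem_psp (hcen : ∀ x : G, x * c = c * x) (Q : G) (S : Finset (CMF G c →₀ ℤ)) {x : CMF G c →₀ ℤ}
    (hx : x ∈ Submodule.span ℤ (pairSet c) ⊔ Submodule.span ℤ (translates c S)) :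
    Finsupp.mapDomain (rt c Q) x ∈ Submodule.span ℤ (pairSet c) ⊔ Submodule.span ℤ (translates c S) := by
  obtain ⟨p, hp, z, hz, rfl⟩ := Submodule.mem_sup.mp hx
  rw [Finsupp.mapDomain_add]
  refine Submodule.add_mem _ (Submodule.mem_sup_left ?_) (Submodule.mem_sup_right (mapDomain_rt_mem_span_translates c Q S hz))
  have h : Submodule.map (Finsupp.lmapDomain ℤ ℤ (rt c Q)) (Submodule.span ℤ (pairSet c)) ≤ Submodule.span ℤ (pairSet c) := by
    rw [Submodule.map_span, Submodule.span_le]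
    rintro _ ⟨_, ⟨Ψ, rfl⟩, rfl⟩
    rw [Finsupp.lmapDomain_apply, mapDomain_rt_pair_eq c hcen]
    exact Submodule.subset_span (pair_mem_pairSet c _)
  exact h (Submodule.mem_map_of_mem hp)

/-- The indicator of a base change: `1_{Ψ·Q⁻¹}(x) = 1_Ψ(xQ)`. [folklore] -/
theorem indG_rt (Q : G) (Ψ : CMF G c) (x : G) : indG (rt c Q Ψ).1 x = indG Ψ.1 (x * Q) := by
  unfold indG
  by_cases h : x * Q ∈ Ψ.1
  · rw [if_pos ((mem_rt c Q Ψ x).mpr h), if_pos h]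
  · rw [if_neg (fun h' => h ((mem_rt c Q Ψ x).mp h')), if_neg h]

/-- **The type sum of a base change** is the translated type sum: `typeSum (y·Q⁻¹) x = typeSum y (xQ)`. [folklore] -/
theorem typeSum_mapDomain_rt (Q : G) (y : CMF G c →₀ ℤ) (x : G) :
    typeSum G c (Finsupp.mapDomain (rt c Q) y) x = typeSum G c y (x * Q) := by
  induction y using Finsupp.induction_linear with
  | zero => simp only [Finsupp.mapDomain_zero, map_zero, Pi.zero_apply]
  | add y z hy hz => simp only [Finsupp.mapDomain_add, map_add, Pi.add_apply, hy, hz]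
  | single Ψ k =>
    rw [Finsupp.mapDomain_single, ← Finsupp.smul_single_one (rt c Q Ψ) k, ← Finsupp.smul_single_one Ψ k, map_smul, map_smul,
      Pi.smul_apply, Pi.smul_apply, typeSum_single, typeSum_single, indG_rt]

/-! ## §2 Potential descent -/

section Descent

variable (P : CMF G c → ℕ) (Res : CMF G c → Prop)

/-- One clearing step: modulo a submodule `L` holding a `P`-lowering face relation through every non-residual type, a vector whose
non-residual support has potential `< k + 1` is congruent to one whose non-residual support has potential `< k`. [folklore] -/
theorem clear_step (hc2 : c * c = 1) (L : Submodule ℤ (CMF G c →₀ ℤ))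
    (hL : ∀ Ψ : CMF G c, ¬ Res Ψ → ∃ t t' : G, gface c hc2 Ψ t t' ∈ L ∧
      P (oflipCM c hc2 t Ψ) < P Ψ ∧ P (oflipCM c hc2 t' Ψ) < P Ψ ∧ P (oflipCM c hc2 t (oflipCM c hc2 t' Ψ)) < P Ψ)
    (k : ℕ) (y : CMF G c →₀ ℤ) (hy : ∀ Ψ ∈ y.support, Res Ψ ∨ P Ψ < k + 1) :
    ∃ y' : CMF G c →₀ ℤ, y - y' ∈ L ∧ ∀ Ψ ∈ y'.support, Res Ψ ∨ P Ψ < k := by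
  classical
  -- a relation `[Ψ] + w` through each non-residual type, with `w` invisible at potential `≥ P Ψ`
  have hF : ∀ Ψ : CMF G c, ¬ Res Ψ → ∃ v : CMF G c →₀ ℤ, v ∈ L ∧ ∃ w : CMF G c →₀ ℤ,
      (∀ Φ : CMF G c, P Ψ ≤ P Φ → w Φ = 0) ∧ v = Finsupp.single Ψ 1 + w := by
    intro Ψ hΨ
    obtain ⟨t, t', hv, h₁, h₂, h₃⟩ := hL Ψ hΨ
    refine ⟨_, hv, Finsupp.single (oflipCM c hc2 t (oflipCM c hc2 t' Ψ)) 1 - Finsupp.single (oflipCM c hc2 t Ψ) 1 -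
      Finsupp.single (oflipCM c hc2 t' Ψ) 1, fun Φ hΦ => ?_, by rw [gface]; abel⟩
    have n1 : oflipCM c hc2 t Ψ ≠ Φ := by rintro rfl; omega
    have n2 : oflipCM c hc2 t' Ψ ≠ Φ := by rintro rfl; omega
    have n3 : oflipCM c hc2 t (oflipCM c hc2 t' Ψ) ≠ Φ := by rintro rfl; omega
    simp only [Finsupp.sub_apply, Finsupp.single_apply, if_neg n1, if_neg n2, if_neg n3, sub_zero]
  choose! F hFmem W hW hFeq using hF
  set Bk : Finset (CMF G c) := y.support.filter fun Ψ => ¬ Res Ψ ∧ P Ψ = k with hBk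
  set q : CMF G c →₀ ℤ := ∑ Ψ ∈ Bk, y Ψ • F Ψ with hq
  have hqmem : q ∈ L := Submodule.sum_mem _ fun Ψ hΨ => Submodule.smul_mem _ _ (hFmem Ψ (Finset.mem_filter.mp hΨ).2.1)
  -- values of `q` at non-residual types of potential `≥ k`
  have hqval : ∀ Φ : CMF G c, ¬ Res Φ → k ≤ P Φ → q Φ = if Φ ∈ Bk then y Φ else 0 := by
    intro Φ hΦ1 hΦk
    rw [hq, Finsupp.finsetSum_apply]
    have hterm : ∀ Ψ ∈ Bk, (y Ψ • F Ψ) Φ = if Φ = Ψ then y Ψ else 0 := by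
      intro Ψ hΨ
      obtain ⟨-, hΨ1, hΨk⟩ := Finset.mem_filter.mp hΨ
      rw [Finsupp.smul_apply, smul_eq_mul, hFeq Ψ hΨ1, Finsupp.add_apply, hW Ψ hΨ1 Φ (by omega), add_zero,
        Finsupp.single_apply]
      by_cases h : Ψ = Φ
      · rw [if_pos h, if_pos h.symm, mul_one]
      · rw [if_neg h, if_neg (fun h' => h h'.symm), mul_zero]
    rw [Finset.sum_congr rfl hterm, Finset.sum_ite_eq]
  refine ⟨y - q, by rw [sub_sub_cancel]; exact hqmem, fun Φ hΦ => ?_⟩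
  by_contra hbad
  push Not at hbad
  obtain ⟨hΦ1, hΦk⟩ := hbad
  rw [Finsupp.mem_support_iff, Finsupp.sub_apply, hqval Φ hΦ1 hΦk] at hΦ
  by_cases hB' : Φ ∈ Bk
  · rw [if_pos hB', sub_self] at hΦ; exact hΦ rfl
  · rw [if_neg hB', sub_zero] at hΦ
    have hsupp : Φ ∈ y.support := Finsupp.mem_support_iff.mpr hΦ
    rcases hy Φ hsupp with h | h
    · exact hΦ1 h
    · exact hB' (Finset.mem_filter.mpr ⟨hsupp, hΦ1, by omega⟩)

/-- **THE POTENTIAL DESCENT.**  If `L` holds through every non-residual type a face relation whose three other corners have smaller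
potential, every vector is congruent modulo `L` to one supported on residual types. [folklore] -/
theorem descent (hc2 : c * c = 1) (L : Submodule ℤ (CMF G c →₀ ℤ))
    (hL : ∀ Ψ : CMF G c, ¬ Res Ψ → ∃ t t' : G, gface c hc2 Ψ t t' ∈ L ∧
      P (oflipCM c hc2 t Ψ) < P Ψ ∧ P (oflipCM c hc2 t' Ψ) < P Ψ ∧ P (oflipCM c hc2 t (oflipCM c hc2 t' Ψ)) < P Ψ)
    (y : CMF G c →₀ ℤ) : ∃ y' : CMF G c →₀ ℤ, y - y' ∈ L ∧ ∀ Ψ ∈ y'.support, Res Ψ := by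
  classical
  suffices h : ∀ k : ℕ, ∀ y : CMF G c →₀ ℤ, (∀ Ψ ∈ y.support, Res Ψ ∨ P Ψ < k) →
      ∃ y' : CMF G c →₀ ℤ, y - y' ∈ L ∧ ∀ Ψ ∈ y'.support, Res Ψ by
    obtain ⟨K, hK⟩ := Finset.exists_le (y.support.image P)
    exact h (K + 1) y fun Ψ hΨ => Or.inr (Nat.lt_succ_of_le (hK _ (Finset.mem_image_of_mem P hΨ)))
  intro k
  induction k with
  | zero =>
    intro y hy
    exact ⟨y, by rw [sub_self]; exact Submodule.zero_mem _, fun Ψ hΨ => (hy Ψ hΨ).resolve_right (Nat.not_lt_zero _)⟩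
  | succ k ih =>
    intro y hy
    obtain ⟨y₁, h₁, hy₁⟩ := clear_step c P Res hc2 L hL k y hy
    obtain ⟨y₂, h₂, hy₂⟩ := ih y₁ hy₁
    exact ⟨y₂, by rw [show y - y₂ = (y - y₁) + (y₁ - y₂) from by abel]; exact Submodule.add_mem _ h₁ h₂, hy₂⟩

end Descent

/-! ## §3 Restricted star reduction -/

section Star

variable (T₀ : CMF G c) (U : CMF G c → Prop)

/-- The star form of a type: `θ_{T₀}(typeSum [Φ]) = Σ_{t ∈ T₀ ∖ Φ} ([T₀^{(t)}] − [T₀]) + [T₀]`. [folklore] -/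
theorem thetaG_typeSum_single (hc2 : c * c = 1) (Φ : CMF G c) :
    thetaG c hc2 T₀ (typeSum G c (Finsupp.single Φ 1)) =
      (∑ t ∈ T₀.1 \ Φ.1, (Finsupp.single (oflipCM c hc2 t T₀) 1 - Finsupp.single T₀ 1)) + Finsupp.single T₀ 1 := by
  rw [typeSum_single, thetaG_apply, indG_pair c Φ 1, one_smul]
  congr 1
  rw [← Finset.sum_sdiff (Finset.sdiff_subset (t := Φ.1) (s := T₀.1))]
  have h0 : ∑ t ∈ T₀.1 \ (T₀.1 \ Φ.1), indG Φ.1 (c * t) • (Finsupp.single (oflipCM c hc2 t T₀) 1 - Finsupp.single T₀ 1) =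
      (0 : CMF G c →₀ ℤ) := by
    refine Finset.sum_eq_zero fun t ht => ?_
    have htΦ : t ∈ Φ.1 := by
      rw [Finset.mem_sdiff, Finset.mem_sdiff] at ht
      by_contra h
      exact ht.2 ⟨ht.1, h⟩
    have h : indG Φ.1 (c * t) = 0 := by
      unfold indG; rw [if_neg ((Φ.2 t).mp htΦ)]
    rw [h, zero_smul]
  rw [h0, zero_add]
  refine Finset.sum_congr rfl fun t ht => ?_
  have htΦ : t ∉ Φ.1 := (Finset.mem_sdiff.mp ht).2
  have h : indG Φ.1 (c * t) = 1 := by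
    unfold indG
    rw [if_pos (by by_contra hh; exact htΦ ((Φ.2 t).mpr hh))]
  rw [h, one_smul]

/-- **RESTRICTED STAR REDUCTION.**  Let `L` hold, through every type `Φ` of the class `U` deviating from `T₀` at `≥ 2` places, a face relation at
two distinct deviation places whose three other corners lie in `U`.  Then `[Φ] − θ_{T₀}(typeSum [Φ]) ∈ L` for every `Φ ∈ U` (the Prior induction
`single_sub_thetaG_mem`, with the faces supplied by `L` instead of all faces). [folklore] -/
theorem single_sub_thetaG_mem_of (hc2 : c * c = 1) (L : Submodule ℤ (CMF G c →₀ ℤ))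
    (hL : ∀ Φ : CMF G c, U Φ → 2 ≤ (T₀.1 \ Φ.1).card → ∃ s s' : G, s ∈ T₀.1 \ Φ.1 ∧ s' ∈ T₀.1 \ Φ.1 ∧ s ≠ s' ∧
      gface c hc2 Φ s s' ∈ L ∧ U (oflipCM c hc2 s Φ) ∧ U (oflipCM c hc2 s' Φ) ∧ U (oflipCM c hc2 s (oflipCM c hc2 s' Φ))) :
    ∀ Φ : CMF G c, U Φ → Finsupp.single Φ 1 - thetaG c hc2 T₀ (typeSum G c (Finsupp.single Φ 1)) ∈ L := by
  suffices h : ∀ (n : ℕ) (Φ : CMF G c), (T₀.1 \ Φ.1).card = n → U Φ →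
      Finsupp.single Φ 1 - thetaG c hc2 T₀ (typeSum G c (Finsupp.single Φ 1)) ∈ L from fun Φ hU => h _ Φ rfl hU
  intro n
  induction n using Nat.strong_induction_on with
  | h n ih =>
  intro Φ hn hU
  rcases n with _ | (_ | m)
  · -- deviation ∅: `Φ = T₀`
    have hΦ : Φ = T₀ := eq_of_dev_empty c (Finset.card_eq_zero.mp hn)
    rw [hΦ, thetaG_typeSum_single, Finset.sdiff_self, Finset.sum_empty, zero_add, sub_self]
    exact Submodule.zero_mem _
  · -- deviation `{s}`: `Φ = T₀^{(s)}`
    obtain ⟨s, hs⟩ := Finset.card_eq_one.mp hn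
    have hd : Φ = oflipCM c hc2 s T₀ := eq_oflip_of_dev_singleton c hc2 hs
    rw [thetaG_typeSum_single, hs, Finset.sum_singleton, sub_add_cancel, ← hd, sub_self]
    exact Submodule.zero_mem _
  · -- deviation of size `m + 2`: the supplied face, then induct on the three corners
    obtain ⟨s, s', hsD, hs'D, hss', hface, hU1, hU2, hU3⟩ := hL Φ hU (by omega)
    have hsT : s ∈ T₀.1 := (Finset.mem_sdiff.mp hsD).1
    have hsΦ : s ∉ Φ.1 := (Finset.mem_sdiff.mp hsD).2
    have hs'T : s' ∈ T₀.1 := (Finset.mem_sdiff.mp hs'D).1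
    have hs'Φ : s' ∉ Φ.1 := (Finset.mem_sdiff.mp hs'D).2
    have hs'O : s' ∉ orb c s := by
      rw [mem_orb]
      rintro (h1 | h1)
      · exact hss' h1.symm
      · exact ((T₀.2 s).mp hsT) (h1 ▸ hs'T)
    have hdev1 : (T₀.1 \ (oflipCM c hc2 s Φ).1).card = m + 1 := by
      rw [dev_oflip c hc2 hsT hsΦ, Finset.card_erase_of_mem hsD]; omega
    have hdev2 : (T₀.1 \ (oflipCM c hc2 s' Φ).1).card = m + 1 := by
      rw [dev_oflip c hc2 hs'T hs'Φ, Finset.card_erase_of_mem hs'D]; omega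
    have hsflip : s ∉ (oflipCM c hc2 s' Φ).1 := by
      change s ∉ oflip c s' Φ.1
      have hsO' : s ∉ orb c s' := by
        rw [mem_orb]
        rintro (h1 | h1)
        · exact hss' h1
        · exact ((T₀.2 s').mp hs'T) (h1 ▸ hsT)
      intro hmem
      rw [oflip, Finset.mem_symmDiff] at hmem
      rcases hmem with ⟨h1, -⟩ | ⟨h1, -⟩
      · exact hsΦ h1
      · exact hsO' h1
    have hdev3 : (T₀.1 \ (oflipCM c hc2 s (oflipCM c hc2 s' Φ)).1).card = m := by
      rw [dev_oflip c hc2 hsT hsflip, dev_oflip c hc2 hs'T hs'Φ,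
        Finset.card_erase_of_mem (Finset.mem_erase.mpr ⟨hss', hsD⟩), Finset.card_erase_of_mem hs'D]
      omega
    have key : Finsupp.single Φ 1 - thetaG c hc2 T₀ (typeSum G c (Finsupp.single Φ 1))
        = (gface c hc2 Φ s s' - thetaG c hc2 T₀ (typeSum G c (gface c hc2 Φ s s')))
          + (Finsupp.single (oflipCM c hc2 s Φ) 1 - thetaG c hc2 T₀ (typeSum G c (Finsupp.single (oflipCM c hc2 s Φ) 1)))
          + (Finsupp.single (oflipCM c hc2 s' Φ) 1 - thetaG c hc2 T₀ (typeSum G c (Finsupp.single (oflipCM c hc2 s' Φ) 1)))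
          - (Finsupp.single (oflipCM c hc2 s (oflipCM c hc2 s' Φ)) 1
              - thetaG c hc2 T₀ (typeSum G c (Finsupp.single (oflipCM c hc2 s (oflipCM c hc2 s' Φ)) 1))) := by
      simp only [gface, map_add, map_sub]
      abel
    rw [key]
    refine Submodule.sub_mem _ (Submodule.add_mem _ (Submodule.add_mem _ ?_ ?_) ?_) ?_
    · rw [typeSum_gface c hc2 Φ hs'O, map_zero, sub_zero]
      exact hface
    · exact ih (m + 1) (by omega) _ hdev1 hU1
    · exact ih (m + 1) (by omega) _ hdev2 hU2
    · exact ih m (by omega) _ hdev3 hU3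

end Star

end

end Summit.HodgeConjecture.CorCM.Census.TwistGeneration
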